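import Literature.NumberTheory.GaloisRepresentations.ContinuousH1AddEquivSignTwistProofs
import Literature.NumberTheory.EllipticCurves.Kato2004.IwasawaCohomology
import Literature.NumberTheory.EllipticCurves.TateModuleQuadraticTwistEquivProofs
import Literature.NumberTheory.EllipticCurves.CyclotomicZpExtensionLayerOneSqrtTwoProofs
import Mathlib.FieldTheory.Galois.Infinite
import Mathlib.NumberTheory.Padics.PadicVal.Basic
import HarnessLib

/-!
# The layer cohomology of a quadratic twist along a `ℤ_p`-tower: additive isomorphisms
# `ψ_n : H¹(ℚ_{n+1}, T_pW′) ≃+ H¹(ℚ_{n+1}, T_pW)` (`n ≥ 0`), `ℤ_p`-linear, trace-compatible and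
# ANTI-commuting with `conj_γ`, from `T_pW ≅ T_pW′ ⊗ χ` with `χ` trivial on `Gal(ℚ̄/ℚ₁)` and `χ(γ) = −1`;
# the case `p = 2`, `W′` a model of `W^{(2)}`, `χ = χ₂` (proofs only; 0 def, 0 fact)

Topic `NumberTheory/EllipticCurves`, sub-directory `Kato2004` (namespace = path). THEOREMS ONLY: no
definition, no named fact, no `instance`, no notation, no `sorry`; nothing about any main conjecture or BSD
is asserted.

**The point** (Rubin, *Euler systems* VI §1–§2; Greenberg LNM 1716 §4 p. 107: `H¹(F_∞, A_s) = H¹(F_∞, A) ⊗ s`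
for a character `s` of `Γ = Gal(F_∞/F)`). The adapter `Kato2004.iwasawaH1Data_exists_negTwist` (file
`IwasawaUnitTwistH1Proofs`) twists Kato's pinned Iwasawa cohomology `𝐇¹_Γ(T_pW)` into `𝐇¹_Γ(T_pW′)` with
`Λ` acting through `Tw : (1+T) ↦ −(1+T)`, GIVEN additive isomorphisms of the layer groups
`ψ_n : H¹(ℚ_{n+1}, T_pW′) ≃+ H¹(ℚ_{n+1}, T_pW)` (`n ≥ 0`) that are `ℤ_p`-linear, compatible with the
corestrictions `Cor : H¹(ℚ_{n+2}, ·) → H¹(ℚ_{n+1}, ·)` and ANTI-commute with `conj_γ`. This file CONSTRUCTS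
them:

* `exists_layerIsos_of_tateModule_equiv` (any `p`, any `ℤ_p`-extension `κ` of `ℚ`, any `γ`) — from a
  continuous `ℤ_p`-linear isomorphism `E : T_pW′ ≃ T_pW` (continuous inverse) with `E(σx) = σE(x)` for
  `σ ∈ κ⁻¹(pℤ_p) = Gal(ℚ̄/ℚ₁)` and `E(γx) = −γE(x)`: on every layer group `U_{n+1} = Gal(ℚ̄/ℚ_{n+1}) ≤ U₁` the
  map `E` is `U_{n+1}`-equivariant, so `ψ_n := E_*` on `H¹(U_{n+1}, ·)` (tree `mapH1AddHom`,
  `exists_addEquiv_apply_eq_mapH1AddHom`); `ℤ_p`-linearity = `mapH1AddHom_smul`, trace compatibility =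
  `mapH1AddHom_coresLe` (the layer corestriction `Kato2004.layerCores` IS a `coresLe`), the sign under
  `conj_γ` = `mapH1AddHom_conjMap_of_neg`.
* `smul_geomSqrt_two_of_mem_layerSubgroup_one` / `smul_geomSqrt_two_of_not_mem_layerSubgroup_one`
  (`p = 2`, `κ` cyclotomic): `Gal(ℚ̄/ℚ₁)` fixes `√2` (`ℚ₁ = ℚ(√2)`, tree
  `ZpExtension.IsCyclotomic.exists_sq_eq_two_layer_one`) and every `g ∉ Gal(ℚ̄/ℚ₁)` maps `√2 ↦ −√2` (the
  stabiliser of `√2` contains the index-`2` subgroup `Gal(ℚ̄/ℚ₁)` and is proper since `√2 ∉ ℚ`) — the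
  argument of seat `bsd-2adic-t42` GEN 22 (`AddSelmerTwistTwo.smul_eq_neg_of_not_mem_layerSubgroup_one`,
  Summits side), re-run here for the tree's `WeierstrassCurve.geomSqrt 2` so that Literature can use it.
* **`exists_layerIsos_of_smul_eq_quadraticTwist_two`** (`p = 2`): for `W, W₂` elliptic over `ℚ` with
  `C • W₂ = W^{(2)}` for a change of variables `C` (any model of the twist by `2`), `κ` cyclotomic and
  `γ ∉ Gal(ℚ̄/ℚ₁)` (e.g. a topological generator: `…_of_isTopGenerator`), the family `ψ_n` with the three
  properties — the `I`-half of the Galois reading (iii) of R15 in GROUP-LEVEL currency, exactly the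
  hypotheses `(ψ, hψ_smul, hψ_cores, hψ_conj)` of `iwasawaH1Data_exists_negTwist`; the isomorphism
  `E : T₂W₂ ≃ T₂W` with `E(σx) = ±σE(x)` by `σ√2 = ±√2` is the tree's
  `WeierstrassCurve.exists_tateModule_equiv_of_smul_eq_quadraticTwist` (Silverman *AEC* X.5 Cor. 5.4).

Motivation: cell `bsd-2adic`, seat `k4-w3` GEN 3, crux stmt-BirchSwinnertonDyer-22618 C4″ (the `(−2)`-split-twist
blocks are the `(−1)`-blocks at `W^{(2)}`); the companion Selmer-side isomorphism `φ` is seat `t42`'s.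

## References
* [Rubin2000] K. Rubin, *Euler systems*, Ch. VI §1–§2 (twisting by characters of `Γ`), App. B §2.
* [GreenbergLNM1716] R. Greenberg, LNM 1716 (1999), §4 p. 107.
* [SilvermanAEC2009] J. H. Silverman, *AEC* 2nd ed., X.5 Cor. 5.4 (`E^{(d)} ≅ E` over `K(√d)`), III.§7.
* [Washington1997] L. C. Washington, *Cyclotomic Fields*, §13.1 (`ℚ₁ = ℚ(√2)` in the cyclotomic `ℤ₂`-extension).
* [SerreGaloisCohomology1997] J.-P. Serre, *Galois Cohomology*, I §2.2, §2.4.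
-/

noncomputable section

open scoped NumberField
open Field CategoryTheory
open Literature.NumberTheory.GaloisRepresentations
open Literature.NumberTheory.EllipticCurves Literature.NumberTheory.EllipticCurves.Kato2004.EulerSystemValues

namespace Literature.NumberTheory.EllipticCurves.Kato2004

/-! ## §1 Any prime: the layer isomorphisms from a sign-twisted equivariant `T_pW′ ≃ T_pW` -/

section AnyPrime

variable {W W' : WeierstrassCurve ℚ} [W.IsElliptic] [W'.IsElliptic] {p : ℕ} [Fact p.Prime]
  [ContinuousSMul ℤ_[p] (W.tateModule p)] [ContinuousSMul ℤ_[p] (W'.tateModule p)]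
  (κ : ZpExtension ℚ p) (γ : absoluteGaloisGroup ℚ)

/-- **The layer isomorphisms of a character twist.** Let `E : T_pW′ ≃ T_pW` be `ℤ_p`-linear, continuous
with continuous inverse, equivariant for `U₁ = κ⁻¹(pℤ_p) = Gal(ℚ̄/ℚ₁)` and with `E(γx) = −γE(x)`. Then there
are additive isomorphisms `ψ_n : H¹(ℚ_{n+1}, T_pW′) ≃+ H¹(ℚ_{n+1}, T_pW)` (`n ≥ 0`; `ψ_n = E_*` on
`H¹(Gal(ℚ̄/ℚ_{n+1}), ·)`), `ℤ_p`-linear, compatible with the corestrictions `Kato2004.layerCores` and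
anti-commuting with `conj_γ` — the hypotheses of `Kato2004.iwasawaH1Data_exists_negTwist`.
[cite: Rubin2000, Ch. VI §1–§2] [cite: GreenbergLNM1716, §4 (p. 107)] [cite: SerreGaloisCohomology1997, I §2.2, §2.4] -/
theorem exists_layerIsos_of_tateModule_equiv (E : W'.tateModule p ≃ₗ[ℤ_[p]] W.tateModule p)
    (hE : Continuous E) (hE' : Continuous E.symm)
    (hfix : ∀ σ ∈ κ.layerSubgroup 1, ∀ x : W'.tateModule p, E (σ • x) = σ • E x)
    (hγ : ∀ x : W'.tateModule p, E (γ • x) = -(γ • E x)) :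
    ∃ ψ : ∀ n : ℕ, H1 (tateRep W' p) (κ.layerSubgroup (n + 1)) ≃+ H1 (tateRep W p) (κ.layerSubgroup (n + 1)),
      (∀ (n : ℕ) (c : ℤ_[p]) (y : H1 (tateRep W' p) (κ.layerSubgroup (n + 1))),
        ψ n (c • y) = c • ψ n y) ∧
      (∀ (n : ℕ) (y : H1 (tateRep W' p) (κ.layerSubgroup (n + 2))),
        layerCores (tateRep W p) κ (n + 1) (ψ (n + 1) y) = ψ n (layerCores (tateRep W' p) κ (n + 1) y)) ∧
      (∀ (n : ℕ) (y : H1 (tateRep W' p) (κ.layerSubgroup (n + 1))),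
        ψ n (conjMap (tateRep W' p).toTopRep (κ.layerSubgroup (n + 1)) γ 1 y) =
          -conjMap (tateRep W p).toTopRep (κ.layerSubgroup (n + 1)) γ 1 (ψ n y)) := by
  -- `E` as an additive isomorphism, equivariant on every layer group `U_{n+1} ≤ U₁`
  set e : W'.tateModule p ≃+ W.tateModule p := E.toAddEquiv with he_def
  have he : Continuous e := hE
  have he' : Continuous e.symm := hE'
  have hle : ∀ n : ℕ, κ.layerSubgroup (n + 1) ≤ κ.layerSubgroup 1 := fun n ↦
    κ.layerSubgroup_antitone (Nat.le_add_left 1 n)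
  have hU : ∀ (n : ℕ) (g : κ.layerSubgroup (n + 1)) (x : W'.tateModule p),
      e ((subgroupRep (tateRep W' p).toTopRep (κ.layerSubgroup (n + 1))).ρ g x) =
        (subgroupRep (tateRep W p).toTopRep (κ.layerSubgroup (n + 1))).ρ g (e x) :=
    fun n g x ↦ hfix (g : absoluteGaloisGroup ℚ) (hle n g.2) x
  have hU' : ∀ (n : ℕ) (g : κ.layerSubgroup (n + 1)) (y : W.tateModule p),
      e.symm ((subgroupRep (tateRep W p).toTopRep (κ.layerSubgroup (n + 1))).ρ g y) =
        (subgroupRep (tateRep W' p).toTopRep (κ.layerSubgroup (n + 1))).ρ g (e.symm y) :=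
    fun n g y ↦ symm_apply_ρ_of_apply_ρ (X := subgroupRep (tateRep W' p).toTopRep (κ.layerSubgroup (n + 1)))
      (Y := subgroupRep (tateRep W p).toTopRep (κ.layerSubgroup (n + 1))) e (hU n) g y
  -- the isomorphisms `ψ_n = E_*`
  choose ψ hψ _hψ' using fun n : ℕ ↦
    exists_addEquiv_apply_eq_mapH1AddHom (X := subgroupRep (tateRep W' p).toTopRep (κ.layerSubgroup (n + 1)))
      (Y := subgroupRep (tateRep W p).toTopRep (κ.layerSubgroup (n + 1))) e he he' (hU n) (hU' n)
  refine ⟨ψ, fun n c y ↦ ?_, fun n y ↦ ?_, fun n y ↦ ?_⟩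
  · -- `ℤ_p`-linear
    rw [hψ, hψ]
    exact mapH1AddHom_smul _ he (hU n) c (fun x ↦ E.map_smul c x) y
  · -- trace-compatible: `layerCores` is a `coresLe`, and `E_*` commutes with `coresLe`
    rw [hψ, hψ]
    unfold layerCores
    exact (mapH1AddHom_coresLe (X := (tateRep W' p).toTopRep) (Y := (tateRep W p).toTopRep) e.toAddMonoidHom
      he _ _ (hF := _) (hU (n + 1)) (hU n) y).symm
  · -- anti-commutes with `conj_γ`
    rw [hψ, hψ]
    exact mapH1AddHom_conjMap_of_neg (X := (tateRep W' p).toTopRep) (Y := (tateRep W p).toTopRep)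
      e.toAddMonoidHom he γ (fun x ↦ hγ x) (hU n) y

end AnyPrime

/-! ## §2 `p = 2`: `Gal(ℚ̄/ℚ₁)` fixes `√2`, and `g ∉ Gal(ℚ̄/ℚ₁)` maps `√2 ↦ −√2` -/

section SqrtTwo

variable (κ : ZpExtension ℚ 2)

/-- `2` is not a rational square (`v₂(q²)` is even, `v₂(2) = 1`). [folklore] -/
private theorem not_exists_rat_sq_eq_two' : ¬ ∃ q : ℚ, q ^ 2 = 2 := by
  rintro ⟨q, hq⟩
  have h := congrArg (padicValRat 2) hq
  rw [padicValRat.pow, show (2 : ℚ) = ((2 : ℕ) : ℚ) by norm_num, padicValRat.self (by norm_num)] at h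
  omega

/-- **`Gal(ℚ̄/ℚ₁)` fixes `√2`** for every cyclotomic `ℤ₂`-extension `κ` of `ℚ`: `ℚ₁ = ℚ(√2)` contains a
square root `θ` of `2` (tree `ZpExtension.IsCyclotomic.exists_sq_eq_two_layer_one`), and the tree's chosen
`√2 = WeierstrassCurve.geomSqrt 2 = ±θ`. [cite: Washington1997, §13.1] -/
theorem smul_geomSqrt_two_of_mem_layerSubgroup_one (hκ : κ.IsCyclotomic) {σ : absoluteGaloisGroup ℚ}
    (hσ : σ ∈ κ.layerSubgroup 1) :
    σ • WeierstrassCurve.geomSqrt (2 : ℚ) = WeierstrassCurve.geomSqrt (2 : ℚ) := by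
  obtain ⟨⟨θ, hθ1⟩, hθ2⟩ := ZpExtension.IsCyclotomic.exists_sq_eq_two_layer_one hκ
  have hfixθ : σ • θ = θ := by
    have hmem : θ ∈ IntermediateField.fixedField
        ((κ.layerSubgroup 1).map (absoluteGaloisGroup.toAlgEquiv ℚ).toMonoidHom) := hθ1
    exact (IntermediateField.mem_fixedField_iff _ _).mp hmem _ ⟨σ, hσ, rfl⟩
  have hθ2' : θ ^ 2 = (2 : AlgebraicClosure ℚ) := by
    have h := congrArg (fun x : κ.layer 1 ↦ (x : AlgebraicClosure ℚ)) hθ2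
    simp only [SubmonoidClass.mk_pow] at h
    exact h
  have hg2 : WeierstrassCurve.geomSqrt (2 : ℚ) ^ 2 = (2 : AlgebraicClosure ℚ) := by
    rw [WeierstrassCurve.geomSqrt_sq, map_ofNat]
  have hsq : WeierstrassCurve.geomSqrt (2 : ℚ) ^ 2 = θ ^ 2 := hg2.trans hθ2'.symm
  rcases sq_eq_sq_iff_eq_or_eq_neg.mp hsq with h | h
  · rw [h, hfixθ]
  · rw [h, smul_neg, hfixθ]

/-- **Every `g ∉ Gal(ℚ̄/ℚ₁)` maps `√2 ↦ −√2`** (`κ` cyclotomic): the stabiliser of `√2` in `Γ_ℚ` contains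
the index-`2` subgroup `Gal(ℚ̄/ℚ₁) = κ⁻¹(2ℤ₂)` (`smul_geomSqrt_two_of_mem_layerSubgroup_one`,
`ZpExtension.index_layerSubgroup`) and is not all of `Γ_ℚ` (else `√2 ∈ ℚ`,
`InfiniteGalois.mem_range_algebraMap_iff_fixed`), so it IS `Gal(ℚ̄/ℚ₁)`; and `g√2 = ±√2` always. Argument of
seat `bsd-2adic-t42` GEN 22 (Summits `AddSelmerTwistTwo.smul_eq_neg_of_not_mem_layerSubgroup_one`).
[cite: Washington1997, §13.1] -/
theorem smul_geomSqrt_two_of_not_mem_layerSubgroup_one (hκ : κ.IsCyclotomic) {g : absoluteGaloisGroup ℚ}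
    (hg : g ∉ κ.layerSubgroup 1) :
    g • WeierstrassCurve.geomSqrt (2 : ℚ) = -WeierstrassCurve.geomSqrt (2 : ℚ) := by
  haveI : IsGalois ℚ (AlgebraicClosure ℚ) :=
    @IsAlgClosure.isGalois ℚ (AlgebraicClosure ℚ) _ _ (AlgebraicClosure.instAlgebra ℚ) inferInstance inferInstance
  rcases WeierstrassCurve.map_geomSqrt (absoluteGaloisGroup.toAlgEquiv ℚ g) (2 : ℚ) with h | h
  swap
  · exact h
  exfalso
  set θ : AlgebraicClosure ℚ := WeierstrassCurve.geomSqrt (2 : ℚ) with hθ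
  -- the stabiliser `S` of `θ`
  set S : Subgroup (absoluteGaloisGroup ℚ) := MulAction.stabilizer (absoluteGaloisGroup ℚ) θ with hS
  have hle : κ.layerSubgroup 1 ≤ S := fun σ hσ ↦ smul_geomSqrt_two_of_mem_layerSubgroup_one κ hκ hσ
  have hgS : g ∈ S := h
  -- `S ≠ ⊤`: otherwise `θ` is rational
  have hStop : S ≠ ⊤ := by
    intro htop
    have hfix : ∀ f : AlgebraicClosure ℚ ≃ₐ[ℚ] AlgebraicClosure ℚ, f θ = θ := fun f ↦ by
      have hf : (show absoluteGaloisGroup ℚ from f) ∈ S := by rw [htop]; exact Subgroup.mem_top _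
      exact hf
    obtain ⟨q, hq⟩ :=
      (InfiniteGalois.mem_range_algebraMap_iff_fixed (k := ℚ) (K := AlgebraicClosure ℚ) θ).2 hfix
    have hg2 : WeierstrassCurve.geomSqrt (2 : ℚ) ^ 2 = (2 : AlgebraicClosure ℚ) := by
      rw [WeierstrassCurve.geomSqrt_sq, map_ofNat]
    apply not_exists_rat_sq_eq_two'
    refine ⟨q, ?_⟩
    apply (algebraMap ℚ (AlgebraicClosure ℚ)).injective
    rw [map_pow, hq, map_ofNat, hθ]
    exact hg2
  -- `[Γ : κ⁻¹(2ℤ₂)] = 2` and `κ⁻¹(2ℤ₂) ≤ S < ⊤` force `S = κ⁻¹(2ℤ₂)`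
  have hidx : (κ.layerSubgroup 1).index = 2 := by rw [κ.index_layerSubgroup 1, pow_one]
  have hSidx : S.index ∣ 2 := hidx ▸ Subgroup.index_dvd_of_le hle
  have hS1 : S.index ≠ 1 := fun h1 ↦ hStop (Subgroup.index_eq_one.mp h1)
  have hS2 : S.index = 2 := by
    rcases (Nat.dvd_prime Nat.prime_two).mp hSidx with h1 | h2
    · exact absurd h1 hS1
    · exact h2
  have hrel : (κ.layerSubgroup 1).relIndex S = 1 := by
    have h := Subgroup.relIndex_mul_index hle
    rw [hidx, hS2] at h
    omega
  have hSle : S ≤ κ.layerSubgroup 1 := Subgroup.relIndex_eq_one.mp hrel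
  exact hg (hSle hgS)

/-- A topological generator `γ` of `Gal(ℚ_∞/ℚ)` (`κ γ = 1`) is not in `κ⁻¹(2ℤ₂) = Gal(ℚ̄/ℚ₁)` (`2 ∤ 1`).
[cite: Washington1997, §13.2] -/
theorem not_mem_layerSubgroup_one_of_isTopGenerator' {γ : absoluteGaloisGroup ℚ}
    (hγ : κ.IsTopGenerator γ) : γ ∉ κ.layerSubgroup 1 := by
  rw [ZpExtension.mem_layerSubgroup, show κ γ = Multiplicative.ofAdd 1 from hγ, toAdd_ofAdd, pow_one]
  intro h
  exact (Prime.not_dvd_one (PadicInt.prime_p (p := 2))) h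

end SqrtTwo

/-! ## §3 `p = 2`: the layer isomorphisms for a model of the twist by `2` -/

section Two

variable {W W₂ : WeierstrassCurve ℚ} [W.IsElliptic] [W₂.IsElliptic]
  [ContinuousSMul ℤ_[2] (W.tateModule 2)] [ContinuousSMul ℤ_[2] (W₂.tateModule 2)]
  (κ : ZpExtension ℚ 2) (γ : absoluteGaloisGroup ℚ)

/-- **The `I`-half of R15 (iii) in group-level currency.** For `W, W₂` elliptic over `ℚ` with
`C • W₂ = W^{(2)}` (any model of the quadratic twist by `2`), `κ` a cyclotomic `ℤ₂`-extension and
`γ ∉ Gal(ℚ̄/ℚ₁)`: additive isomorphisms `ψ_n : H¹(ℚ_{n+1}, T₂W₂) ≃+ H¹(ℚ_{n+1}, T₂W)` (`n ≥ 0`),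
`ℤ₂`-linear, compatible with the corestrictions `layerCores`, and ANTI-commuting with `conj_γ` — from
`T₂W ≅ T₂W₂ ⊗ χ₂` (`WeierstrassCurve.exists_tateModule_equiv_of_smul_eq_quadraticTwist`: `E(σx) = ±σE(x)` by
`σ√2 = ±√2`; `√2 ∈ ℚ₁`, `γ√2 = −√2`). These are the hypotheses `(ψ, hψ_smul, hψ_cores, hψ_conj)` of
`Kato2004.iwasawaH1Data_exists_negTwist`. [cite: GreenbergLNM1716, §4 (p. 107)] [cite: Rubin2000, Ch. VI §1–§2]
[cite: SilvermanAEC2009, X.5 Cor. 5.4] -/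
theorem exists_layerIsos_of_smul_eq_quadraticTwist_two (C : WeierstrassCurve.VariableChange ℚ)
    (hW₂ : C • W₂ = W.quadraticTwist 2) (hκ : κ.IsCyclotomic) (hγ : γ ∉ κ.layerSubgroup 1) :
    ∃ ψ : ∀ n : ℕ, H1 (tateRep W₂ 2) (κ.layerSubgroup (n + 1)) ≃+ H1 (tateRep W 2) (κ.layerSubgroup (n + 1)),
      (∀ (n : ℕ) (c : ℤ_[2]) (y : H1 (tateRep W₂ 2) (κ.layerSubgroup (n + 1))),
        ψ n (c • y) = c • ψ n y) ∧
      (∀ (n : ℕ) (y : H1 (tateRep W₂ 2) (κ.layerSubgroup (n + 2))),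
        layerCores (tateRep W 2) κ (n + 1) (ψ (n + 1) y) = ψ n (layerCores (tateRep W₂ 2) κ (n + 1) y)) ∧
      (∀ (n : ℕ) (y : H1 (tateRep W₂ 2) (κ.layerSubgroup (n + 1))),
        ψ n (conjMap (tateRep W₂ 2).toTopRep (κ.layerSubgroup (n + 1)) γ 1 y) =
          -conjMap (tateRep W 2).toTopRep (κ.layerSubgroup (n + 1)) γ 1 (ψ n y)) := by
  obtain ⟨E, hc, hc', hfix, hneg⟩ :=
    W.exists_tateModule_equiv_of_smul_eq_quadraticTwist W₂ C (d := (2 : ℚ)) two_ne_zero hW₂ 2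
  exact exists_layerIsos_of_tateModule_equiv κ γ E hc hc'
    (fun σ hσ x ↦ hfix σ (smul_geomSqrt_two_of_mem_layerSubgroup_one κ hκ hσ) x)
    (fun x ↦ hneg γ (smul_geomSqrt_two_of_not_mem_layerSubgroup_one κ hκ hγ) x)

/-- `exists_layerIsos_of_smul_eq_quadraticTwist_two` keyed by a topological generator `γ` of `Gal(ℚ_∞/ℚ)`
(`κ γ = 1`, so `γ ∉ κ⁻¹(2ℤ₂)` and `χ₂(γ) = −1`). [cite: GreenbergLNM1716, §4 (p. 107)] [cite: Rubin2000, Ch. VI §1–§2] -/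
theorem exists_layerIsos_of_smul_eq_quadraticTwist_two_of_isTopGenerator (C : WeierstrassCurve.VariableChange ℚ)
    (hW₂ : C • W₂ = W.quadraticTwist 2) (hκ : κ.IsCyclotomic) (hγ : κ.IsTopGenerator γ) :
    ∃ ψ : ∀ n : ℕ, H1 (tateRep W₂ 2) (κ.layerSubgroup (n + 1)) ≃+ H1 (tateRep W 2) (κ.layerSubgroup (n + 1)),
      (∀ (n : ℕ) (c : ℤ_[2]) (y : H1 (tateRep W₂ 2) (κ.layerSubgroup (n + 1))),
        ψ n (c • y) = c • ψ n y) ∧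
      (∀ (n : ℕ) (y : H1 (tateRep W₂ 2) (κ.layerSubgroup (n + 2))),
        layerCores (tateRep W 2) κ (n + 1) (ψ (n + 1) y) = ψ n (layerCores (tateRep W₂ 2) κ (n + 1) y)) ∧
      (∀ (n : ℕ) (y : H1 (tateRep W₂ 2) (κ.layerSubgroup (n + 1))),
        ψ n (conjMap (tateRep W₂ 2).toTopRep (κ.layerSubgroup (n + 1)) γ 1 y) =
          -conjMap (tateRep W 2).toTopRep (κ.layerSubgroup (n + 1)) γ 1 (ψ n y)) :=
  exists_layerIsos_of_smul_eq_quadraticTwist_two κ γ C hW₂ hκ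
    (not_mem_layerSubgroup_one_of_isTopGenerator' κ hγ)

end Two

end Literature.NumberTheory.EllipticCurves.Kato2004

end
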